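import Literature.Analysis.ValidatedNumerics.MultiPrecisionInterval
import HarnessLib

/-!
# Sections of `ζ` beyond `σ = 1`: the vertical-shift construction — the executable checker

Barrier catalogue `Literature/Barriers/RiemannHypothesis/`, companion of
`TuranPartialSumsShift{EM,Abel,Theta,Blocks,Main,Enclose}.lean` (helper files for the discharge of
`TuranPartialSums`). This file is PURE COMPUTATION (integer interval arithmetic on the tree's engine
`Literature.Analysis.ValidatedNumerics.NumericsMP`, scale `S = 2^60`); its meaning is the soundness theorem of
`TuranPartialSumsShiftCheckSound.lean`:
`checkCell c = true → ∀ N ≥ 360000` with `L = log N ∈ [c.n1/c.d, c.n2/c.d]` (`n2 = 0`: no upper end),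
`‖Bval N‖ < Rval N` and the side condition of the criterion — i.e. the vertical-shift phases
`ω(p) = p^{-iτ}`, `τ = (29/4)/log N`, produce a zero of `ζ_N` with `σ > 1`.

## The check (all quantities in `τ`-scaled units, `τ = X/L`, `X = 29/4`, `w = 1/L`)

For a cell `L ∈ [L1, L2]`:
* `d0 ∋ τ c₀(τ)` from `τ S(30)` (30 explicit terms `τ e^{−iτ log k}/k`, centred form in `τ`), the
  Euler–Maclaurin integral `(1 − 30^{−iτ})(−i)` and half-term, widened by `τ/1800`
  (`norm_tau_emConst_sub_le`, `‖s(s+1)‖ ≤ 8`);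
* the `u`-grid `[½, 1] = ⋃_j [a_j, b_j]`, `KU = 512` cells: a box `∋ τ S(N/⌈N^u⌉), τ S(N/⌊N^u⌋)` —
  either the hull of the exact boxes `τ S(m)`, `m_lo ≤ m ≤ m_hi ≤ 20`, or
  `(1 − e^{−iX(1−u)})(−i) + d0` widened by `τ (1.5/m_lo + 1/(t_lo − 1) + 1/(2 m_lo²))`
  (`norm_tau_powSum_ceil/floor_sub_le`); from it the pieces of the four `u`-integrals
  (`re/im_integral_bounds`, `integral_bounds_real`) with the envelope ratio bound `etaHat`
  (`thetaEnv_div_le_table/sylv/max`);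
* the scalar terms `sliver, tiny, deltaB/R, bdry, Jsum, side` in the closed forms of
  `TuranPartialSumsShiftEnclose.lean`;
* accept iff `UB < LB` and `side < LB` (strict integer comparisons at scale `S`).

## References

* R. E. Moore, *Interval Analysis* (1966), Ch. 3–4. [folklore]
* The tree's `MultiPrecisionInterval.lean` (engine) and `TuranPartialSumsBoxCert.lean` (same design).
-/

open Literature.Analysis.ValidatedNumerics.NumericsMP
open Literature.Analysis.ValidatedNumerics (Numerics.cdiv)

namespace Literature.Barriers.RiemannHypothesis

namespace TuranShift

namespace Cert

/-! ## Parameters -/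

/-- The scale `S = 2^60`. [folklore] -/
def S : ℕ := 1152921504606846976

/-- Number of `u`-subcells of `[½, 1]`. [folklore] -/
def KU : ℕ := 512

/-- Blocks `m ≤ M0` are treated exactly. [folklore] -/
def M0 : ℕ := 20

/-- Euler–Maclaurin start for the constant `c₀`. [folklore] -/
def KC : ℕ := 30

/-- Split point of the `J`-sum. [folklore] -/
def MJ : ℕ := 100

/-- Taylor terms / halvings of `expI`. [folklore] -/
def KE : ℕ := 16
/-- [folklore] -/
def kE : ℕ := 4
/-- Taylor terms / halvings of `exp`. [folklore] -/
def KX : ℕ := 24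
/-- [folklore] -/
def kX : ℕ := 6
/-- Series terms of `log`. [folklore] -/
def KL : ℕ := 64
/-- Machin terms of `π`. [folklore] -/
def KP : ℕ := 44

/-- A cell of the covering: `L = log N ∈ [n1/d, n2/d]`; `n2 = 0` encodes `+∞`. [folklore] -/
structure Cell where
  /-- numerator of `L1` -/
  n1 : ℕ
  /-- numerator of `L2` (`0` = no upper end) -/
  n2 : ℕ
  /-- common denominator -/
  d : ℕ
  deriving DecidableEq, Repr, Inhabited

/-! ## Small helpers on boxes -/

/-- Componentwise hull of two boxes. [folklore] -/
def boxHull (A B : MC) : MC := ⟨A.re.hull B.re, A.im.hull B.im⟩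

/-- Upper bound for `‖z‖ · S` on a box (Euclidean, by an integer square root). [folklore] -/
def normHi (A : MC) : ℕ := Nat.sqrt (A.re.absHi.natAbs ^ 2 + A.im.absHi.natAbs ^ 2) + 1

/-- Lower bound for `|x| · S` on an interval. [folklore] -/
def absLo (I : MI) : ℕ := if I.lo ≤ 0 ∧ 0 ≤ I.hi then 0 else min I.lo.natAbs I.hi.natAbs

/-- Lower bound for `‖z‖ · S` on a box. [folklore] -/
def normLo (A : MC) : ℕ := Nat.sqrt (absLo A.re ^ 2 + absLo A.im ^ 2)

/-- The outward interval `[⌊pS/q⌋, ⌈p'S/q'⌉]` of a pair of fractions. [folklore] -/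
def fracSpan (p q p' q' : ℕ) : MI := ⟨(p : ℤ) * S / q, Numerics.cdiv ((p' : ℤ) * S) q'⟩

/-- Midpoint and radius of an interval (integer midpoint, radius rounded up). [folklore] -/
def midRad (T : MI) : ℤ × ℤ :=
  let mid := (T.lo + T.hi) / 2
  (mid, max (T.hi - mid) (mid - T.lo))

/-- `e^{−iθ}` for `θ ∈ Θ`: the conjugate of the engine's `expI`. [folklore] -/
def expNegI (piI Θ : MI) : Option MC :=
  (MC.expI S KE kE piI Θ).map MC.conj

/-- `e^{−iθ}` on `Θ` in centred form: the value at the midpoint widened by the radius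
(`|e^{−iθ} − e^{−iθ₀}| ≤ |θ − θ₀|`). [folklore] -/
def expNegIC (piI Θ : MI) : Option MC :=
  (expNegI piI ⟨(midRad Θ).1, (midRad Θ).1⟩).map fun E ↦ E.widen (midRad Θ).2

/-! ## The `τ`-interval of a cell and the power-sum boxes -/

/-- `X = 29/4` as a thin interval. [folklore] -/
def XI : MI := fracSpan 29 4 29 4

/-- `τ = X/L ∈ [29 d/(4 n2), 29 d/(4 n1)]` (`n2 = 0`: lower end `0`). [folklore] -/
def tauI (c : Cell) : MI :=
  ⟨if c.n2 = 0 then 0 else (29 * c.d : ℕ) * (S : ℤ) / (4 * c.n2 : ℕ),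
   Numerics.cdiv ((29 * c.d : ℕ) * (S : ℤ)) (4 * c.n1)⟩

/-- The `k`-th term `τ e^{−iτ log k}/k` for `τ ∈ T` (`T.lo ≥ 0`), in centred form: the value at
`τ₀ = mid T` widened by `rad T · (1 + τ_hi log k)/k`. [folklore] -/
def powTerm (piI T : MI) (k : ℕ) : Option MC :=
  match MI.logNat S KL k with
  | none => none
  | some Lk =>
    match expNegI piI (MI.mul S ⟨(midRad T).1, (midRad T).1⟩ Lk) with
    | none => none
    | some Em =>
      some (((Em.mulMI S ⟨(midRad T).1, (midRad T).1⟩).divNat k).widen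
        (Numerics.cdiv (Numerics.cdiv ((midRad T).2 *
          (S + Numerics.cdiv (max T.hi 0 * max Lk.hi 0) S)) S) k))

/-- `e^{−iτ log k}` for `τ ∈ T` in centred form (Lipschitz constant `log k`). [folklore] -/
def powPhase (piI T : MI) (k : ℕ) : Option MC :=
  match MI.logNat S KL k with
  | none => none
  | some Lk =>
    match expNegI piI (MI.mul S ⟨(midRad T).1, (midRad T).1⟩ Lk) with
    | none => none
    | some Em => some (Em.widen (Numerics.cdiv ((midRad T).2 * max Lk.hi 0) S))

/-- The box of `τ S(n) = ∑_{k ≤ n} τ e^{−iτ log k}/k`. [folklore] -/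
def powSums (piI T : MI) : ℕ → Option MC
  | 0 => some (MC.ofInt S 0)
  | k + 1 =>
    match powSums piI T k, powTerm piI T (k + 1) with
    | some acc, some t => some (acc.add t)
    | _, _ => none

/-- The box `d0 ∋ τ c₀`: `τ S(KC) − (1 − KC^{−iτ})(−i) − τ KC^{−iτ}/(2 KC)`, widened by `τ/1800`.
[folklore] -/
def d0Box (piI T : MI) : Option MC :=
  match powSums piI T KC, powPhase piI T KC with
  | some A, some E =>
      some (((A.sub (((MC.ofInt S 1).sub E).mulNegI)).sub ((E.mulMI S T).divNat (2 * KC))).widen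
        (Numerics.cdiv (max T.hi 0) 1800))
  | _, _ => none

/-- **Bisection in `τ`.** Evaluate the box-valued `f` on the `2^depth` parts of `T` and take the
hull: fights the dependency loss of the centred forms on wide `τ`-cells. [folklore] -/
def splitHull (f : MI → Option MC) : ℕ → MI → Option MC
  | 0, T => f T
  | n + 1, T =>
    match splitHull f n ⟨T.lo, (T.lo + T.hi) / 2⟩, splitHull f n ⟨(T.lo + T.hi) / 2, T.hi⟩ with
    | some A, some B => some (boxHull A B)
    | _, _ => none

/-- Bisection depth for `d0`. [folklore] -/
def DEPTH0 : ℕ := 4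

/-- Bisection depth for the small blocks. [folklore] -/
def DEPTHS : ℕ := 3

/-- The list of boxes `∋ τ S(m)`, `m = 0, …, n − 1` (index `m`). [folklore] -/
def tSList (piI T : MI) : ℕ → Option (List MC)
  | 0 => some []
  | n + 1 =>
    match tSList piI T n, splitHull (fun T' ↦ powSums piI T' n) DEPTHS T with
    | some l, some b => some (l ++ [b])
    | _, _ => none

/-- Hull of the list entries `l[m]`, `mlo ≤ m ≤ mhi` (`none` if out of range or empty). [folklore] -/
def listHull (l : List MC) (mlo : ℕ) : ℕ → Option MC
  | 0 => if mlo = 0 then l[0]? else none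
  | k + 1 =>
    if mlo = k + 1 then l[k + 1]?
    else if mlo ≤ k then
      match listHull l mlo k, l[k + 1]? with
      | some H, some B => some (boxHull H B)
      | _, _ => none
    else none

/-! ## The envelope ratio bound -/

/-- `16.001`, `0.0864`, `0.0722` scaled (rounded up). [folklore] -/
def c16001 : ℤ := Numerics.cdiv (16001 * (S : ℤ)) 1000
/-- [folklore] -/
def c0864 : ℤ := Numerics.cdiv (864 * (S : ℤ)) 10000
/-- [folklore] -/
def c0722 : ℤ := Numerics.cdiv (722 * (S : ℤ)) 10000

/-- The exponent `min(v/2, 60)` as a thin lower interval, for `v ∈ V`. [folklore] -/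
def halfCap (V : MI) : MI :=
  if (V.divNat 2).lo ≤ 60 * (S : ℤ) then MI.lower (V.divNat 2) else MI.ofInt S 60

/-- Upper bound (scaled) of `e^{−v/2}` for `v ∈ V`. [folklore] -/
def expNegHalfHi (V : MI) : Option ℤ :=
  (MI.exp S KX kX (halfCap V).neg).map MI.hi

/-- `tableEnv(e^v)/e^v = v² e^{−v/2}/(8π)`: an enclosure at `v ∈ V`. [folklore] -/
def tableI (piI V : MI) : Option MI :=
  match expNegHalfHi V with
  | none => none
  | some e => MI.divPos S ((MI.sqr S V).mul S ⟨0, e⟩) (piI.mulInt 8)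

/-- `sylvEnv(e^v)/e^v = 0.0722 + (10 + 2v) e^{−v/2}`: an upper bound at `v ∈ V` (scaled). [folklore] -/
def sylvHi (V : MI) : Option ℤ :=
  match expNegHalfHi V with
  | none => none
  | some e => some (c0722 + (((MI.ofInt S 10).add (V.mulInt 2)).mul S ⟨0, e⟩).hi)

/-- **The envelope ratio bound** `η̂/S ≥ thetaEnv(t)/t` for all `t ≥ e^{v}`, `v ∈ V` (`v ≥ 4`), and
`t ≤ Z` when `belowZ`: table regime, Chebyshev regime (`V.lo > 16.001`), or the maximum of the table
value and the junction constant `0.0864`. [folklore] -/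
def etaHat (piI V : MI) (belowZ : Bool) : Option ℤ :=
  if belowZ then (tableI piI V).map MI.hi
  else if c16001 < V.lo then sylvHi V
  else (tableI piI V).map fun t ↦ max t.hi c0864

/-! ## One `u`-subcell -/

/-- The data produced on the `u`-subcell `[a_j, b_j]`: the box product `E_j · box_j` (for `IB`),
and the scaled contributions to `IR` (lower), `IEB`, `IER` (upper). [folklore] -/
structure UOut where
  /-- `∋ (2 KU) ∫_{a_j}^{b_j} e^{−iXu}/u · τ S(N/⌈N^u⌉) du` -/
  P : MC
  /-- `≤ S ∫_{a_j}^{b_j} ‖τ S(N/⌈N^u⌉)‖/u du` -/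
  ir : ℤ
  /-- `≥ S ∫_{a_j}^{b_j}` of the `B` variation integrand (times `τ`) -/
  ieb : ℤ
  /-- `≥ S ∫_{a_j}^{b_j}` of the `R` variation integrand (times `τ`) -/
  ier : ℤ

/-- Lower index bound `m_lo` on the subcell (from `q ≥ e^{(1 − b_j) L1}` and `t/(t+1) ≥ 600/601`).
[folklore] -/
def mLo (c : Cell) (j : ℕ) : Option ℕ :=
  if 14 * (2 * KU * c.d) ≤ (2 * KU - (KU + j + 1)) * c.n1 then some 1000000
  else
    match MI.exp S KX kX (fracSpan ((2 * KU - (KU + j + 1)) * c.n1) (2 * KU * c.d)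
        ((2 * KU - (KU + j + 1)) * c.n1) (2 * KU * c.d)) with
    | none => none
    | some Q => some (max 1 ((max Q.lo 0).toNat * 600 / (601 * S)))

/-- The exponent `min(a_j L1, 60)` as a thin lower interval. [folklore] -/
def vCap (c : Cell) (j : ℕ) : MI :=
  if (KU + j) * c.n1 ≤ 60 * (2 * KU * c.d) then
    MI.lower (fracSpan ((KU + j) * c.n1) (2 * KU * c.d) ((KU + j) * c.n1) (2 * KU * c.d))
  else MI.ofInt S 60

/-- `e0/S ≥ e^{−a_j L1} ≥ 1/t` on the subcell (`e0 < S` checked). [folklore] -/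
def tInv (c : Cell) (j : ℕ) : Option ℤ :=
  match MI.exp S KX kX (vCap c j).neg with
  | none => none
  | some E => if max E.hi 0 < (S : ℤ) then some (max E.hi 0) else none

/-- Upper index bound `m_hi` on the subcell, when `L2 < ∞` and `(1 − a_j) L2 ≤ 3.1`. [folklore] -/
def mHi (c : Cell) (j : ℕ) (e0 : ℤ) : Option ℕ :=
  if c.n2 = 0 then none
  else if 10 * ((2 * KU - (KU + j)) * c.n2) ≤ 31 * (2 * KU * c.d) then
    match MI.exp S KX kX (fracSpan ((2 * KU - (KU + j)) * c.n2) (2 * KU * c.d)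
        ((2 * KU - (KU + j)) * c.n2) (2 * KU * c.d)) with
    | some Q => some ((max Q.hi 0).toNat / ((S : ℤ) - e0).toNat)
    | none => none
  else none

/-- The exact-blocks branch: the hull of `tS[m]`, `m_lo ≤ m ≤ m_hi ≤ M0`, when available. [folklore] -/
def smallBox (c : Cell) (tS : List MC) (j : ℕ) (mlo : ℕ) (e0 : ℤ) : Option MC :=
  match mHi c j e0 with
  | some mhi => if mhi ≤ M0 ∧ mlo ≤ mhi then listHull tS mlo mhi else none
  | none => none

/-- The widening radius `τ (1.5/m_lo + 1/(t−1) + 1/(2 m_lo²))` of the continuous branch (scaled).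
[folklore] -/
def epsW (T : MI) (mlo : ℕ) (e0 : ℤ) : ℤ :=
  Numerics.cdiv (max T.hi 0 * 3) (2 * mlo) +
    Numerics.cdiv (max T.hi 0 * Numerics.cdiv (e0 * S) ((S : ℤ) - e0)) S +
    Numerics.cdiv (max T.hi 0) (2 * mlo ^ 2)

/-- The box `∋ τ S(N/⌈N^u⌉), τ S(N/⌊N^u⌋)` on the subcell `j`. [folklore] -/
def blockBox (c : Cell) (T : MI) (tS : List MC) (d0 A0 : MC) (j : ℕ) : Option MC :=
  match mLo c j, tInv c j with
  | some mlo, some e0 =>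
    match smallBox c tS j mlo e0 with
    | some H => some H
    | none => some ((A0.add d0).widen (epsW T mlo e0))
  | _, _ => none

/-- `e^{−iXu}/u` on the subcell (centred form in `u`). [folklore] -/
def eBox (piI : MI) (j : ℕ) : Option MC :=
  (expNegIC piI (fracSpan (29 * (KU + j)) (8 * KU) (29 * (KU + j + 1)) (8 * KU))).map fun E ↦
    E.mulMI S (fracSpan (2 * KU) (KU + j + 1) (2 * KU) (KU + j))

/-- `(1 − e^{−iX(1−u)})(−i)` on the subcell (centred form in `u`). [folklore] -/
def a0Box (piI : MI) (j : ℕ) : Option MC :=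
  (expNegIC piI (fracSpan (29 * (KU - j - 1)) (8 * KU) (29 * (KU - j)) (8 * KU))).map fun F ↦
    ((MC.ofInt S 1).sub F).mulNegI

/-- `c_hi · S` with `c = ‖1 + iτ‖ ≤ 1 + τ²/2`. [folklore] -/
def cHiS (T : MI) : ℤ := S + Numerics.cdiv (max T.hi 0 * max T.hi 0) (2 * S)

/-- The `IEB` contribution from `g ≥ η̂ · nhi / S`: `g (c_hi/a_j + w2/a_j²)/(2 KU)` scaled. [folklore] -/
def iebOf (c : Cell) (T : MI) (j : ℕ) (g : ℤ) : ℤ :=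
  Numerics.cdiv (g * cHiS T) ((S : ℤ) * (KU + j : ℕ)) +
    Numerics.cdiv (g * c.d * (2 * KU : ℕ)) ((c.n1 : ℤ) * (KU + j : ℕ) ^ 2)

/-- The `IER` contribution: `g (1/a_j + w2/a_j²)/(2 KU)` scaled. [folklore] -/
def ierOf (c : Cell) (j : ℕ) (g : ℤ) : ℤ :=
  Numerics.cdiv g (KU + j : ℕ) + Numerics.cdiv (g * c.d * (2 * KU : ℕ)) ((c.n1 : ℤ) * (KU + j : ℕ) ^ 2)

/-- The envelope bound on the subcell: `v = a_j L1`, `belowZ ↔ b_j L2 ≤ 16`. [folklore] -/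
def etaU (piI : MI) (c : Cell) (j : ℕ) : Option ℤ :=
  etaHat piI (fracSpan ((KU + j) * c.n1) (2 * KU * c.d) ((KU + j) * c.n1) (2 * KU * c.d))
    (decide (0 < c.n2 ∧ (KU + j + 1) * c.n2 ≤ 16 * (2 * KU) * c.d))

/-- The subcell computation. [folklore] -/
def uStep (piI : MI) (c : Cell) (T : MI) (tS : List MC) (d0 : MC) (j : ℕ) : Option UOut :=
  match a0Box piI j, eBox piI j, etaU piI c j with
  | some A0, some E, some eta =>
    match blockBox c T tS d0 A0 j with
    | none => none
    | some box =>
      some ⟨MC.mul S E box, (normLo box : ℤ) / (KU + j + 1 : ℕ),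
        iebOf c T j (Numerics.cdiv (max eta 0 * normHi box) S),
        ierOf c j (Numerics.cdiv (max eta 0 * normHi box) S)⟩
  | _, _, _ => none

/-- Running sums over the subcells. [folklore] -/
structure USum where
  /-- `∑ P_j` -/
  IB : MC
  /-- `∑ ir_j` -/
  IR : ℤ
  /-- `∑ ieb_j` -/
  IEB : ℤ
  /-- `∑ ier_j` -/
  IER : ℤ

/-- The sums over the subcells `j < n`. [folklore] -/
def uSums (piI : MI) (c : Cell) (T : MI) (tS : List MC) (d0 : MC) : ℕ → Option USum
  | 0 => some ⟨MC.ofInt S 0, 0, 0, 0⟩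
  | j + 1 =>
    match uSums piI c T tS d0 j, uStep piI c T tS d0 j with
    | some s, some o => some ⟨s.IB.add o.P, s.IR + o.ir, s.IEB + o.ieb, s.IER + o.ier⟩
    | _, _ => none

/-! ## The scalar terms -/

/-- `M_lo ≤ ⌊√N⌋`: `max 600 (⌊e^{min(L1/2, 60)}⌋ − 1)`. [folklore] -/
def mSqrtLo (c : Cell) : Option ℕ :=
  (MI.exp S KX kX (if c.n1 ≤ 120 * c.d then MI.lower (fracSpan c.n1 (2 * c.d) c.n1 (2 * c.d))
    else MI.ofInt S 60)).map fun E ↦ max 600 ((max E.lo 0).toNat / S - 1)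

/-- The bracket of `τ δ`: `(c w/2 + w²)/(0.499² M²) + (c w/0.499 + w²/0.499²)/M` at `w ∈ W`, `c ∈ C`.
[folklore] -/
def deltaBracket (W C : MI) (Mlo : ℕ) : MI :=
  (((((MI.mul S C W).divNat 2).add (MI.sqr S W)).mulInt 1000000).divNat (249001 * Mlo ^ 2)).add
    (((((MI.mul S C W).mulInt 1000).divNat 499).add (((MI.sqr S W).mulInt 1000000).divNat 249001)).divNat
      Mlo)

/-- `τ (deltaB or deltaR)` bound: `(τ_hi + X/2)/2 ·` bracket at `w = w2 = d/n1`, `M = M_lo`. [folklore] -/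
def tDelta (c : Cell) (T C : MI) (Mlo : ℕ) : ℤ :=
  (MI.mul S (((MI.upper T).add (fracSpan 29 8 29 8)).divNat 2)
    (deltaBracket (fracSpan c.d c.n1 c.d c.n1) C Mlo)).hi

/-- The coefficient `X w²/((1 − w log m) m)` at `w = w2`, `log m ∈ Lm` (an enclosure). [folklore] -/
def jCoef (c : Cell) (Lm : MI) (m : ℕ) : Option MI :=
  MI.divPos S (((MI.sqr S (fracSpan c.d c.n1 c.d c.n1)).mulInt 29).divNat 4)
    (((MI.ofInt S 1).sub (MI.mul S (fracSpan c.d c.n1 c.d c.n1) Lm)).mulInt m)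

/-- The `m`-th term of the `τ · Jsum` bound: `η_m · X w²/((1 − w log m) m)` (scaled). [folklore] -/
def jTermHi (piI : MI) (c : Cell) (m : ℕ) : Option ℤ :=
  match MI.logNat S KL m with
  | none => none
  | some Lm =>
    if ((fracSpan c.n1 c.d c.n1 c.d).sub Lm).lo < 4 * (S : ℤ) then none
    else
      match etaHat piI ((fracSpan c.n1 c.d c.n1 c.d).sub Lm)
          (decide (0 < c.n2 ∧ (c.n2 : ℤ) * S ≤ (16 * S + Lm.lo) * c.d)), jCoef c Lm m with
      | some eta, some q => some (Numerics.cdiv (max eta 0 * max q.hi 0) S)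
      | _, _ => none

/-- The finite part of the `τ · Jsum` bound, terms `m = 2, …, n + 1`. [folklore] -/
def tJsmall (piI : MI) (c : Cell) : ℕ → Option ℤ
  | 0 => some 0
  | n + 1 =>
    match tJsmall piI c n, jTermHi piI c (n + 2) with
    | some acc, some t => some (acc + t)
    | _, _ => none

/-- `log⁺ (2 (1 − x_lo))` with `x_lo ≤ w1 log MJ` (scaled, an upper bound). [folklore] -/
def logTailHi (c : Cell) : Option ℤ :=
  match MI.logNat S KL MJ, MI.logTwo S KL with
  | some LmJ, some L2 =>
    match MI.logOneSub S KL
      (MI.ofScaled (if c.n2 = 0 then 0 else (c.d : ℤ) * max LmJ.lo 0 / c.n2)) with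
    | some LOS => some (max (L2.hi + LOS.hi) 0)
    | none => none
  | _, _ => none

/-- The tail part of the `τ · Jsum` bound: `τ η_sup log⁺(2 (1 − w1 log MJ))`. [folklore] -/
def tJtail (piI : MI) (c : Cell) (T : MI) : Option ℤ :=
  match etaHat piI (fracSpan c.n1 (2 * c.d) c.n1 (2 * c.d)) (decide (0 < c.n2 ∧ c.n2 ≤ 16 * c.d)),
    logTailHi c with
  | some etaSup, some U => some (Numerics.cdiv (Numerics.cdiv (max T.hi 0 * max etaSup 0) S * U) S)
  | _, _ => none

/-- `τ · bdry` bound: `τ η_N w2 + η_M (2 + ‖d0‖ + τ/1000) 2 w2`. [folklore] -/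
def tBdry (piI : MI) (c : Cell) (T : MI) (d0 : MC) : Option ℤ :=
  match etaHat piI (fracSpan c.n1 c.d c.n1 c.d) (decide (0 < c.n2 ∧ c.n2 ≤ 16 * c.d)),
    etaHat piI ((fracSpan c.n1 (2 * c.d) c.n1 (2 * c.d)).sub (fracSpan 1 600 1 600))
      (decide (0 < c.n2 ∧ c.n2 ≤ 32 * c.d)) with
  | some etaN, some etaM =>
    some (Numerics.cdiv (max T.hi 0 * max etaN 0 * c.d) ((S : ℤ) * c.n1) +
      Numerics.cdiv (max etaM 0 * (2 * S + normHi d0 + Numerics.cdiv (max T.hi 0) 1000) * 2 * c.d)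
        ((S : ℤ) * c.n1))
  | _, _ => none

/-! ## The cell check -/

/-- Admissible cell shape: `d > 0`, `L1 = n1/d ≥ 12.5`, and `n1 ≤ n2` unless `n2 = 0`. [folklore] -/
def Cell.ok (c : Cell) : Bool :=
  decide (0 < c.d ∧ 25 * c.d ≤ 2 * c.n1 ∧ (c.n2 = 0 ∨ c.n1 ≤ c.n2))

/-- The scalar part of the verdict: `(sliver + tiny + τδ_B + τ·bdry + τJ, τδ_R + τ·bdry + τJ, side)`
at scale `S`. [folklore] -/
def scalars (piI : MI) (c : Cell) (T : MI) (d0 : MC) : Option (ℤ × ℤ × ℤ) :=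
  match mSqrtLo c, tBdry piI c T d0, tJsmall piI c (MJ - 1), tJtail piI c T with
  | some Mlo, some tb, some tj1, some tj2 =>
      let th := max T.hi 0
      let sliver := Numerics.cdiv (th * 222) (100 * Mlo)
      let ttiny := Numerics.cdiv th (Mlo ^ 2)
      let tdB := tDelta c T ⟨S, cHiS T⟩ Mlo
      let tdR := tDelta c T (MI.ofInt S 1) Mlo
      let side := Numerics.cdiv ((th + Numerics.cdiv (29 * (S : ℤ)) 8) * 2) (Mlo + 1)
      some (sliver + ttiny + tdB + tb + (tj1 + tj2), tdR + tb + (tj1 + tj2), side)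
  | _, _, _, _ => none

/-- The main-term part of the verdict: `‖(1 − e^{−iX})(−i) + d0 − IB‖ · S` (upper bound). [folklore] -/
def mainNorm (piI : MI) (d0 IBs : MC) : Option ℤ :=
  match expNegI piI XI with
  | some EX => some (normHi (((((MC.ofInt S 1).sub EX).mulNegI).add d0).sub (IBs.divNat (2 * KU))))
  | none => none

/-- The verdict data of a cell: `(UB, LB, side)` at scale `S`, or `none`. [folklore] -/
def cellData (c : Cell) : Option (ℤ × ℤ × ℤ) :=
  if c.ok then
    match MI.pi S KP with
    | none => none
    | some piI =>
      match splitHull (d0Box piI) DEPTH0 (tauI c), tSList piI (tauI c) (M0 + 1) with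
      | some d0, some tS =>
        match uSums piI c (tauI c) tS d0 KU with
        | none => none
        | some us =>
          match mainNorm piI d0 us.IB, scalars piI c (tauI c) d0 with
          | some UB0, some (ub, lb, side) =>
              some (UB0 + ub + us.IEB, us.IR - lb - us.IER, side)
          | _, _ => none
      | _, _ => none
  else none

/-- **The cell check.** [folklore] -/
def checkCell (c : Cell) : Bool :=
  match cellData c with
  | some (UB, LB, side) => decide (UB < LB) && decide (side < LB)
  | none => false

/-- Check a list of cells. [folklore] -/
def checkCells (cs : List Cell) : Bool := cs.all checkCell

end Cert

end TuranShift

end Literature.Barriers.RiemannHypothesis
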